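import Summits.AtomisticToContinuum.HydrodynamicLimit.Theses.PesinPricing
import Summits.AtomisticToContinuum.HydrodynamicLimit.Theorems.JParityClosureOddContactSymmetryGibbsInvariance
import Literature.Dynamics.Ergodic.KolmogorovSinaiEntropyDynamic
import Literature.MathematicalPhysics.KineticTheory.HardSphereEulerProofs
import HarnessLib

/-!
# `PesinPricing.EntropyPerParticle` is an N-uniform lower bound on the Kolmogorov–Sinai entropy

Support file for the statement item stmt-AtomisticToContinuum-9427 (`EntropyPerParticle`, route
`PesinPricing`, sub-problem `HydrodynamicLimit`). The item asks, for every small reduced diameter `σ`,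
for a constant `c > 0` such that for all `N ≥ 1` and all hard-sphere flows `Φ` there is a finite
measurable partition `P` of phase space with
`c (N+1)^{4/3} ≤ liminf_n n⁻¹ ∑_w −G_N(A_w) log G_N(A_w)`, `A_w = ⋂_{m<n} Φ₁^{-m} P_{w m}`,
`G_N = localGibbsLaw σ 1 0 1 N Φ` the homogeneous Gibbs law.

Here we certify what this functional IS, in the vocabulary of the tree's Kolmogorov–Sinai entropy
library (`Literature.Dynamics.Ergodic.KolmogorovSinaiEntropy*`, Walters Ch. 4):

* `sum_negMulLog_iInter_eq_partitionEntropy`: the word sum is the Shannon entropy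
  `H_{G_N}(⋁_{m<n} Φ₁^{-m} ξ)` (`partitionEntropy _ (itinerary Φ₁ ξ n)`) of the itinerary partition of
  the index map `ξ` of `P`;
* `liminf_entropySum_eq_dynEntropy`: since `G_N` is a probability measure (`σ ≤ 1/2`,
  `isProbabilityMeasure_localGibbsLaw`) preserved by every flow map
  (`measurePreserving_flow_localGibbsLaw_const`, Liouville + energy conservation), the `liminf` is a
  limit and equals Walters' `h_{G_N}(Φ₁, ξ)` (`dynEntropy`, Fekete);
* `entropyPerParticle_iff_ksEntropy`: consequently `EntropyPerParticle` is EQUIVALENT to the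
  N-uniform lower bound `c (N+1)^{4/3} ≤ h_{G_N}(Φ₁)` on the Kolmogorov–Sinai entropy
  (`kolmogorovSinaiEntropy`) of the macroscopic time-one map of `N + 1` hard spheres at fixed packing
  fraction `(π/6)σ³` — positivity of the dynamical entropy per particle per collision, uniformly in the
  particle number (the constant changes by a factor `2` in one direction, absorbed in `∃ c`).

No new definitions; pure reformulation lemmas (the right-hand side is written out, not named).

References: P. Walters, *An Introduction to Ergodic Theory* (1982), Ch. 4 (Defs 4.9, 4.10,
Cor. 4.9.1); H. Spohn, *Large Scale Dynamics of Interacting Particles* (1991), Part I §2.3.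
-/

noncomputable section

namespace Summit.AtomisticToContinuum.HydrodynamicLimit.Theorems

open scoped BigOperators Topology Classical MeasureTheory ENNReal
open Filter Set Function MeasureTheory
open Literature.Analysis.FluidPDE Literature.MathematicalPhysics.KineticTheory
  Literature.Dynamics.Ergodic

section Generic

variable {Ω : Type*} {mΩ : MeasurableSpace Ω} {μ : Measure Ω} {k : ℕ}

/-- The word sum of the item is a Shannon entropy: for an index map `ξ : Ω → Fin k` with atoms
`P i = ξ⁻¹{i}`, `∑_{w : Fin n → Fin k} −μ(⋂_{m<n} T^{-m} P_{w m}) log μ(⋂_{m<n} T^{-m} P_{w m})` is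
`H_μ(⋁_{m<n} T^{-m} ξ) = partitionEntropy μ (itinerary T ξ n)` (atoms of the join:
`preimage_itinerary_singleton`; `−(x log x) = Real.negMulLog x`, `neg_mul`). [cite: Walters1982, Def 4.6 and §4.4] -/
theorem sum_negMulLog_iInter_eq_partitionEntropy (μ : Measure Ω) (T : Ω → Ω) {ξ : Ω → Fin k}
    {P : Fin k → Set Ω} (hP : ∀ i, ξ ⁻¹' {i} = P i) (n : ℕ) :
    (∑ w : Fin n → Fin k,
        -(μ.real (⋂ m : Fin n, T^[m.val] ⁻¹' P (w m)) *
          Real.log (μ.real (⋂ m : Fin n, T^[m.val] ⁻¹' P (w m))))) =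
      partitionEntropy μ (itinerary T ξ n) := by
  rw [partitionEntropy_def]
  refine Finset.sum_congr rfl fun w _ => ?_
  rw [preimage_itinerary_singleton, Real.negMulLog, neg_mul]
  simp_rw [hP]

/-- For a measure-preserving map `T` of a probability space and a finite measurable partition with
index map `ξ`, the `liminf` of `n⁻¹ H_μ(⋁_{m<n} T^{-m} ξ)` — written as the item's word sum — is
the dynamical entropy `h_μ(T, ξ)` (the limit exists by subadditivity / Fekete,
`tendsto_partitionEntropy_itinerary_div`). [cite: Walters1982, Cor 4.9.1] -/
theorem liminf_entropySum_eq_dynEntropy [IsProbabilityMeasure μ] {T : Ω → Ω}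
    (hT : MeasurePreserving T μ μ) {ξ : Ω → Fin k} (hξ : Measurable ξ) {P : Fin k → Set Ω}
    (hP : ∀ i, ξ ⁻¹' {i} = P i) :
    liminf (fun n : ℕ => (n : ℝ)⁻¹ * ∑ w : Fin n → Fin k,
        -(μ.real (⋂ m : Fin n, T^[m.val] ⁻¹' P (w m)) *
          Real.log (μ.real (⋂ m : Fin n, T^[m.val] ⁻¹' P (w m))))) atTop =
      dynEntropy μ T ξ := by
  have hfun : (fun n : ℕ => (n : ℝ)⁻¹ * ∑ w : Fin n → Fin k,
        -(μ.real (⋂ m : Fin n, T^[m.val] ⁻¹' P (w m)) *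
          Real.log (μ.real (⋂ m : Fin n, T^[m.val] ⁻¹' P (w m))))) =
      fun n : ℕ => partitionEntropy μ (itinerary T ξ n) / n := by
    funext n
    rw [sum_negMulLog_iInter_eq_partitionEntropy μ T hP n, div_eq_inv_mul]
  rw [hfun]
  exact (tendsto_partitionEntropy_itinerary_div hT hξ).liminf_eq

/-- A finite measurable partition given as a family of sets (measurable, pairwise disjoint,
covering) has a measurable index map `ξ : Ω → Fin k` with atoms `ξ⁻¹{i} = P i`. [folklore] -/
theorem exists_indexMap_of_partition {P : Fin k → Set Ω} (hm : ∀ i, MeasurableSet (P i))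
    (hd : Pairwise (Disjoint on P)) (hu : (⋃ i, P i) = univ) :
    ∃ ξ : Ω → Fin k, Measurable ξ ∧ ∀ i, ξ ⁻¹' {i} = P i := by
  have hex : ∀ z : Ω, ∃ i, z ∈ P i := fun z => by
    have hz : z ∈ ⋃ i, P i := by rw [hu]; exact mem_univ z
    simpa only [mem_iUnion] using hz
  choose ξ hξ using hex
  have hpre : ∀ i, ξ ⁻¹' {i} = P i := by
    intro i
    ext z
    simp only [mem_preimage, mem_singleton_iff]
    constructor
    · rintro rfl
      exact hξ z
    · intro hz
      by_contra hne
      exact Set.disjoint_left.1 (hd hne) (hξ z) hz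
  refine ⟨ξ, measurable_to_countable' fun i => ?_, hpre⟩
  rw [hpre i]
  exact hm i

/-- Conversely the atoms `ξ⁻¹{i}` of a measurable index map form a finite measurable partition
(measurable, pairwise disjoint, covering). [folklore] -/
theorem partition_of_indexMap {ξ : Ω → Fin k} (hξ : Measurable ξ) :
    (∀ i, MeasurableSet (ξ ⁻¹' {i})) ∧ Pairwise (Disjoint on fun i => ξ ⁻¹' {i}) ∧
      (⋃ i, ξ ⁻¹' {i}) = univ :=
  ⟨fun i => hξ (measurableSet_singleton i),
    fun _ _ hij => (Set.disjoint_singleton.2 hij).preimage ξ,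
    Set.iUnion_eq_univ_iff.2 fun z => ⟨ξ z, rfl⟩⟩

end Generic

/-- **`EntropyPerParticle` ⇔ N-uniform Kolmogorov–Sinai entropy lower bound.** The support item
stmt-AtomisticToContinuum-9427 of route `PesinPricing` holds iff there is `σ₀ > 0` such that for every
`0 < σ < σ₀` there is `c > 0` with `c (N+1)^{4/3} ≤ h_{G_N}(Φ₁)` for all `N ≥ 1` and all hard-sphere
flows `Φ` of `N + 1` spheres of diameter `σ(N+1)^{-1/3}` on `𝕋³`, `G_N = localGibbsLaw σ 1 0 1 N Φ` the
homogeneous Gibbs law and `h_{G_N}(Φ₁) = kolmogorovSinaiEntropy G_N (Φ.flow 1)` Walters' entropy of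
the macroscopic time-one map. Ingredients: the item's functional is `h_{G_N}(Φ₁, ξ)` for the index map
of the partition (`liminf_entropySum_eq_dynEntropy`, using that `G_N` is a probability measure for
`σ ≤ 1/2` and `Φ₁`-invariant for EVERY flow, `measurePreserving_flow_localGibbsLaw_const`), and
`h(Φ₁) = sup_ξ h(Φ₁, ξ)`; the constant loses a factor `2` from right to left (strictness in the
supremum), absorbed in `∃ c`, and `σ₀` is cut down to `≤ 1/2` in both directions.
[cite: Walters1982, Def 4.10 with Cor 4.9.1] -/
theorem entropyPerParticle_iff_ksEntropy :
    Theses.PesinPricing.EntropyPerParticle ↔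
      ∃ σ₀ : ℝ, 0 < σ₀ ∧ ∀ σ : ℝ, 0 < σ → σ < σ₀ → ∃ c : ℝ, 0 < c ∧
        ∀ (N : ℕ) (Φ : HardSphereFlow (Torus.geometry (Fin 3)) (hsDiameter σ N) (N + 1)), 1 ≤ N →
          ENNReal.ofReal (c * ((N : ℝ) + 1) ^ (4 / 3 : ℝ)) ≤
            kolmogorovSinaiEntropy (localGibbsLaw σ (fun _ => 1) (fun _ => 0) (fun _ => 1) N Φ)
              (Φ.flow 1) := by
  constructor
  · rintro ⟨σ₀, hσ₀, h⟩
    refine ⟨min σ₀ (1 / 2), lt_min hσ₀ (by norm_num), fun σ hσ hσlt => ?_⟩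
    obtain ⟨c, hc, hcN⟩ := h σ hσ (lt_of_lt_of_le hσlt (min_le_left _ _))
    refine ⟨c, hc, fun N Φ hN => ?_⟩
    have hσ2 : σ ≤ 1 / 2 := (lt_of_lt_of_le hσlt (min_le_right _ _)).le
    haveI : IsProbabilityMeasure (localGibbsLaw σ (fun _ => 1) (fun _ => 0) (fun _ => 1) N Φ) :=
      isProbabilityMeasure_localGibbsLaw continuous_const continuous_const continuous_const
        (fun _ => one_pos) (fun _ => one_pos) hσ2 N Φ
    have hT := measurePreserving_flow_localGibbsLaw_const σ 1 1 0 N Φ 1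
    obtain ⟨k, P, hPm, hPd, hPu, hlim⟩ := hcN N Φ hN
    obtain ⟨ξ, hξ, hξP⟩ := exists_indexMap_of_partition hPm hPd hPu
    have hle : c * ((N : ℝ) + 1) ^ (4 / 3 : ℝ) ≤
        dynEntropy (localGibbsLaw σ (fun _ => 1) (fun _ => 0) (fun _ => 1) N Φ) (Φ.flow 1) ξ :=
      le_of_le_of_eq hlim (liminf_entropySum_eq_dynEntropy hT hξ hξP)
    exact (ENNReal.ofReal_le_ofReal hle).trans
      (ofReal_dynEntropy_le_kolmogorovSinaiEntropy _ _ hξ)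
  · rintro ⟨σ₀, hσ₀, h⟩
    refine ⟨min σ₀ (1 / 2), lt_min hσ₀ (by norm_num), fun σ hσ hσlt => ?_⟩
    obtain ⟨c, hc, hcN⟩ := h σ hσ (lt_of_lt_of_le hσlt (min_le_left _ _))
    refine ⟨c / 2, half_pos hc, fun N Φ hN => ?_⟩
    have hσ2 : σ ≤ 1 / 2 := (lt_of_lt_of_le hσlt (min_le_right _ _)).le
    haveI : IsProbabilityMeasure (localGibbsLaw σ (fun _ => 1) (fun _ => 0) (fun _ => 1) N Φ) :=
      isProbabilityMeasure_localGibbsLaw continuous_const continuous_const continuous_const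
        (fun _ => one_pos) (fun _ => one_pos) hσ2 N Φ
    have hT := measurePreserving_flow_localGibbsLaw_const σ 1 1 0 N Φ 1
    have hpow : 0 < ((N : ℝ) + 1) ^ (4 / 3 : ℝ) := Real.rpow_pos_of_pos (by positivity) _
    have hcp : 0 < c * ((N : ℝ) + 1) ^ (4 / 3 : ℝ) := mul_pos hc hpow
    have hlt : ENNReal.ofReal (c / 2 * ((N : ℝ) + 1) ^ (4 / 3 : ℝ)) <
        kolmogorovSinaiEntropy (localGibbsLaw σ (fun _ => 1) (fun _ => 0) (fun _ => 1) N Φ)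
          (Φ.flow 1) := by
      refine lt_of_lt_of_le ?_ (hcN N Φ hN)
      rw [ENNReal.ofReal_lt_ofReal_iff hcp]
      linarith
    rw [kolmogorovSinaiEntropy_def] at hlt
    simp only [lt_iSup_iff] at hlt
    obtain ⟨k, ξ, hξ, hlt⟩ := hlt
    have hle : c / 2 * ((N : ℝ) + 1) ^ (4 / 3 : ℝ) ≤
        dynEntropy (localGibbsLaw σ (fun _ => 1) (fun _ => 0) (fun _ => 1) N Φ) (Φ.flow 1) ξ :=
      ((ENNReal.ofReal_lt_ofReal_iff_of_nonneg (by positivity)).1 hlt).le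
    obtain ⟨hPm, hPd, hPu⟩ := partition_of_indexMap hξ
    refine ⟨k, fun i => ξ ⁻¹' {i}, hPm, hPd, hPu, ?_⟩
    exact le_of_le_of_eq hle (liminf_entropySum_eq_dynEntropy hT hξ fun _ => rfl).symm

end Summit.AtomisticToContinuum.HydrodynamicLimit.Theorems

end
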